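import Mathlib
import HarnessLib
import Summits.Parity.GeneralizedHardyLittlewood.Theorems.DilatedChowla.Negative.DilatedChowlaMirrorDefs

/-!
# `DilatedChowla` (stmt-Parity-13319): no saving beyond `M^{1/2}` — the Welch / rank floor

Negative lemmas (the tightness record) for the crux `LiouvilleMAD.DilatedChowla` (route
LiouvilleMAD, line `Sketch` = card `siegel-mirror`; notation `S`, `DilatedChowlaAbove` from
`DilatedChowlaMirrorDefs`, entries `L z = λ(z.toNat)` from `DilatedTableChowlaBlocks`).

The `2M` sign vectors `v_n = (λ(mn+c))_{m ∈ (M,2M]}`, `1 ≤ n ≤ 2M`, live in dimension `M`, and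
their Gram matrix is `(S c n n' M)_{n,n'}`.  The fourth-moment identity
`Σ_{n,n'} S(n,n')² = ‖Σ_n v_n v_nᵀ‖_F² = Σ_{m,m'} (Σ_n λ(mn+c) λ(m'n+c))² ≥ Σ_m (Σ_n 1)² = 4M³`
(`sum_sum_sq_gram_comm`, `card_mul_card_sq_le_sum_sum_sq`) against the exact diagonal
`Σ_n S(n,n)² = 2M · M² = 2M³` leaves at least `2M³` on the `2M(2M-1) ≤ 4M²` ordered off-diagonal
pairs (`welch_offDiag`), so some pair `n ≠ n'` has `S² ≥ M/2`, i.e. `|S c n n' M| ≥ √(M/2)`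
(`exists_abs_S_ge_sqrt` — the Welch bound for `2M` sign vectors in `ℝ^M`).  Consequently the
exponent of the crux (`DilatedChowla = DilatedChowlaAbove 0`) can never exceed `1/2`:
`¬ DilatedChowlaAbove (1/2)` (`not_dilatedChowlaAbove_half`). [folklore]
-/

noncomputable section

namespace Summit.Parity.GeneralizedHardyLittlewood.Theorems.DilatedChowla.Negative

open Summit.Parity.GeneralizedHardyLittlewood.Theorems.DilatedTableChowla.Negative
  (L L_mul_self_of_pos)
open Finset Filter

/-! ## §1 Sign matrices: the fourth-moment identity and the Welch floor -/

/-- Fourth-moment identity `‖AAᵀ‖_F² = ‖AᵀA‖_F²`: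
`Σ_{n,n'} (Σ_m a_{nm} a_{n'm})² = Σ_{m,m'} (Σ_n a_{nm} a_{nm'})²` (both sides equal
`Σ_{n,n',m,m'} a_{nm} a_{n'm} a_{nm'} a_{n'm'}`). -/
theorem sum_sum_sq_gram_comm {α β : Type*} (N : Finset α) (I : Finset β) (a : α → β → ℝ) :
    ∑ n ∈ N, ∑ n' ∈ N, (∑ m ∈ I, a n m * a n' m) ^ 2 =
      ∑ m ∈ I, ∑ m' ∈ I, (∑ n ∈ N, a n m * a n m') ^ 2 := by
  calc ∑ n ∈ N, ∑ n' ∈ N, (∑ m ∈ I, a n m * a n' m) ^ 2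
      = ∑ n ∈ N, ∑ n' ∈ N, ∑ m ∈ I, ∑ m' ∈ I, a n m * a n' m * (a n m' * a n' m') := by
        refine sum_congr rfl fun n _ => sum_congr rfl fun n' _ => ?_
        rw [sq, sum_mul_sum]
    _ = ∑ n ∈ N, ∑ m ∈ I, ∑ n' ∈ N, ∑ m' ∈ I, a n m * a n' m * (a n m' * a n' m') := by
        refine sum_congr rfl fun n _ => ?_
        rw [sum_comm]
    _ = ∑ m ∈ I, ∑ n ∈ N, ∑ n' ∈ N, ∑ m' ∈ I, a n m * a n' m * (a n m' * a n' m') := sum_comm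
    _ = ∑ m ∈ I, ∑ n ∈ N, ∑ m' ∈ I, ∑ n' ∈ N, a n m * a n' m * (a n m' * a n' m') := by
        refine sum_congr rfl fun m _ => sum_congr rfl fun n _ => ?_
        rw [sum_comm]
    _ = ∑ m ∈ I, ∑ m' ∈ I, ∑ n ∈ N, ∑ n' ∈ N, a n m * a n' m * (a n m' * a n' m') := by
        refine sum_congr rfl fun m _ => ?_
        rw [sum_comm]
    _ = ∑ m ∈ I, ∑ m' ∈ I, (∑ n ∈ N, a n m * a n m') ^ 2 := by
        refine sum_congr rfl fun m _ => sum_congr rfl fun m' _ => ?_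
        rw [sq, sum_mul_sum]
        exact sum_congr rfl fun n _ => sum_congr rfl fun n' _ => by ring

/-- Diagonal Gram entries of a sign matrix: `Σ_m a_{nm} a_{nm} = #I` when `a_{nm}² = 1` on
`N × I`. -/
theorem sum_mul_self_eq_card {α β : Type*} {N : Finset α} {I : Finset β} {a : α → β → ℝ}
    (ha : ∀ n ∈ N, ∀ m ∈ I, a n m * a n m = 1) {n : α} (hn : n ∈ N) :
    ∑ m ∈ I, a n m * a n m = I.card := by
  rw [sum_congr rfl fun m hm => ha n hn m hm, sum_const, nsmul_eq_mul, mul_one]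

/-- Welch floor for the fourth moment of a sign matrix (`a_{nm}² = 1` on `N × I`):
`#I · #N² ≤ Σ_{n,n'} (Σ_m a_{nm} a_{n'm})²` — transpose by `sum_sum_sq_gram_comm` and keep only
the diagonal `m = m'`, where the entry is `Σ_n a_{nm}² = #N`. -/
theorem card_mul_card_sq_le_sum_sum_sq {α β : Type*} (N : Finset α) (I : Finset β)
    (a : α → β → ℝ) (ha : ∀ n ∈ N, ∀ m ∈ I, a n m * a n m = 1) :
    (I.card : ℝ) * (N.card : ℝ) ^ 2 ≤ ∑ n ∈ N, ∑ n' ∈ N, (∑ m ∈ I, a n m * a n' m) ^ 2 := by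
  rw [sum_sum_sq_gram_comm]
  have hdiag : ∀ m ∈ I, (∑ n ∈ N, a n m * a n m) ^ 2 = (N.card : ℝ) ^ 2 := by
    intro m hm
    rw [sum_congr rfl fun n hn => ha n hn m hm, sum_const, nsmul_eq_mul, mul_one]
  calc (I.card : ℝ) * (N.card : ℝ) ^ 2 = ∑ m ∈ I, (∑ n ∈ N, a n m * a n m) ^ 2 := by
        rw [sum_congr rfl hdiag, sum_const, nsmul_eq_mul]
    _ ≤ ∑ m ∈ I, ∑ m' ∈ I, (∑ n ∈ N, a n m * a n m') ^ 2 :=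
        sum_le_sum fun m hm =>
          single_le_sum (f := fun m' => (∑ n ∈ N, a n m * a n m') ^ 2)
            (fun _ _ => sq_nonneg _) hm

/-- Off-diagonal Welch floor: for a sign matrix (`a_{nm}² = 1` on `N × I`) at least
`#I · #N² − #N · #I²` of the fourth moment sits on the ordered pairs `n ≠ n'` (the diagonal
`n = n'` contributes exactly `#N · #I²`).  For `#N = 2M`, `#I = M` this is `2M³`. -/
theorem welch_offDiag {α β : Type*} [DecidableEq α] (N : Finset α) (I : Finset β)
    (a : α → β → ℝ) (ha : ∀ n ∈ N, ∀ m ∈ I, a n m * a n m = 1) :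
    (I.card : ℝ) * (N.card : ℝ) ^ 2 - N.card * (I.card : ℝ) ^ 2 ≤
      ∑ p ∈ N.offDiag, (∑ m ∈ I, a p.1 m * a p.2 m) ^ 2 := by
  have htot := card_mul_card_sq_le_sum_sum_sq N I a ha
  have hsplit : ∑ n ∈ N, ∑ n' ∈ N, (∑ m ∈ I, a n m * a n' m) ^ 2 =
      ∑ p ∈ N.diag, (∑ m ∈ I, a p.1 m * a p.2 m) ^ 2 +
        ∑ p ∈ N.offDiag, (∑ m ∈ I, a p.1 m * a p.2 m) ^ 2 := by
    rw [← sum_product', ← diag_union_offDiag, sum_union (disjoint_diag_offDiag N)]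
  have hdiag : ∑ p ∈ N.diag, (∑ m ∈ I, a p.1 m * a p.2 m) ^ 2 = N.card * (I.card : ℝ) ^ 2 := by
    rw [sum_diag]
    have h1 : ∀ n ∈ N, (∑ m ∈ I, a n m * a n m) ^ 2 = (I.card : ℝ) ^ 2 := fun n hn => by
      rw [sum_mul_self_eq_card ha hn]
    rw [sum_congr rfl h1, sum_const, nsmul_eq_mul]
  linarith

/-! ## §2 The Welch floor for the pencil sums `S c n n' M` -/

/-- Positivity of the arguments: for `|c| < M`, `1 ≤ n` and `M < m` one has `0 < m·n + c`
(`m·n ≥ m ≥ M + 1 > |c| ≥ -c`). -/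
theorem arg_pos {c : ℤ} {M n m : ℕ} (hcM : |c| < (M : ℤ)) (hn : 1 ≤ n) (hm : M < m) :
    0 < (m : ℤ) * n + c := by
  have h1 : (M : ℤ) + 1 ≤ m := by exact_mod_cast hm
  have h2 : (1 : ℤ) ≤ n := by exact_mod_cast hn
  have h3 : (m : ℤ) ≤ (m : ℤ) * n := le_mul_of_one_le_right (by positivity) h2
  linarith [neg_abs_le c]

/-- The entries of the pencil are signs: for `|c| < M`, `n ∈ [1, 2M]`, `m ∈ (M, 2M]`,
`λ(mn+c) · λ(mn+c) = 1`. -/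
theorem L_mul_self_entry {c : ℤ} {M : ℕ} (hcM : |c| < (M : ℤ)) :
    ∀ n ∈ Icc 1 (2 * M), ∀ m ∈ Ioc M (2 * M),
      L ((m : ℤ) * n + c) * L ((m : ℤ) * n + c) = 1 := by
  intro n hn m hm
  rw [mem_Icc] at hn
  rw [mem_Ioc] at hm
  exact L_mul_self_of_pos (arg_pos hcM hn.1 hm.1)

/-- **Welch / rank floor.** If `|c| < M` then some off-diagonal pencil sum is large:
`√(M/2) ≤ |S c n n' M|` for some `1 ≤ n ≠ n' ≤ 2M`.  The `2M` sign vectors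
`(λ(mn+c))_{m ∈ (M,2M]}` in `ℝ^M` cannot be closer to orthogonal than the Welch bound: the
off-diagonal fourth moment is `≥ 2M³` (`welch_offDiag`) on at most `4M²` ordered pairs. -/
theorem exists_abs_S_ge_sqrt (c : ℤ) (M : ℕ) (hM : (|c| : ℝ) < M) :
    ∃ n n' : ℕ, 1 ≤ n ∧ 1 ≤ n' ∧ n ≠ n' ∧ n ≤ 2 * M ∧ n' ≤ 2 * M ∧
      Real.sqrt ((M : ℝ) / 2) ≤ |S c n n' M| := by
  have hcM : |c| < (M : ℤ) := by exact_mod_cast hM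
  have hM1 : 1 ≤ M := by
    have h0 : (0 : ℤ) < M := lt_of_le_of_lt (abs_nonneg c) hcM
    omega
  have hcardN : ((Icc 1 (2 * M)).card : ℝ) = 2 * M := by
    have h : (Icc 1 (2 * M)).card = 2 * M := by rw [Nat.card_Icc]; omega
    rw [h]; push_cast; ring
  have hcardI : ((Ioc M (2 * M)).card : ℝ) = M := by
    have h : (Ioc M (2 * M)).card = M := by rw [Nat.card_Ioc]; omega
    rw [h]
  -- the off-diagonal fourth moment of the Gram matrix `(S c n n' M)` is at least `2M³`
  have hoff : (M : ℝ) * (2 * M) ^ 2 - 2 * M * (M : ℝ) ^ 2 ≤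
      ∑ p ∈ (Icc 1 (2 * M)).offDiag, (S c p.1 p.2 M) ^ 2 := by
    have h := welch_offDiag (Icc 1 (2 * M)) (Ioc M (2 * M)) (fun n m => L ((m : ℤ) * n + c))
      (L_mul_self_entry hcM)
    rw [hcardN, hcardI] at h
    exact h
  -- there are at most `4M²` ordered off-diagonal pairs, and at least one (`(1, 2)`)
  have hne : ((Icc 1 (2 * M)).offDiag).Nonempty :=
    ⟨(1, 2), by rw [mem_offDiag, mem_Icc, mem_Icc]; omega⟩
  have hcard : (((Icc 1 (2 * M)).offDiag).card : ℝ) ≤ 2 * M * (2 * M) := by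
    have h : ((Icc 1 (2 * M)).offDiag).card ≤ (Icc 1 (2 * M)).card * (Icc 1 (2 * M)).card := by
      rw [offDiag_card]; exact Nat.sub_le _ _
    calc (((Icc 1 (2 * M)).offDiag).card : ℝ)
        ≤ (((Icc 1 (2 * M)).card * (Icc 1 (2 * M)).card : ℕ) : ℝ) := by exact_mod_cast h
      _ = 2 * M * (2 * M) := by push_cast; rw [hcardN]
  -- pigeonhole: some ordered pair `n ≠ n'` carries at least the average `≥ 2M³ / 4M² = M/2`
  have hsum : ∑ _p ∈ (Icc 1 (2 * M)).offDiag, (M : ℝ) / 2 ≤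
      ∑ p ∈ (Icc 1 (2 * M)).offDiag, (S c p.1 p.2 M) ^ 2 := by
    calc ∑ _p ∈ (Icc 1 (2 * M)).offDiag, (M : ℝ) / 2
        = ((Icc 1 (2 * M)).offDiag).card * ((M : ℝ) / 2) := by rw [sum_const, nsmul_eq_mul]
      _ ≤ 2 * M * (2 * M) * ((M : ℝ) / 2) := by gcongr
      _ = (M : ℝ) * (2 * M) ^ 2 - 2 * M * (M : ℝ) ^ 2 := by ring
      _ ≤ ∑ p ∈ (Icc 1 (2 * M)).offDiag, (S c p.1 p.2 M) ^ 2 := hoff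
  obtain ⟨p, hp, hle⟩ := exists_le_of_sum_le hne hsum
  rw [mem_offDiag, mem_Icc, mem_Icc] at hp
  obtain ⟨⟨h1, h2⟩, ⟨h1', h2'⟩, hne'⟩ := hp
  refine ⟨p.1, p.2, h1, h1', hne', h2, h2', ?_⟩
  have h := Real.sqrt_le_sqrt hle
  rwa [Real.sqrt_sq_eq_abs] at h

/-! ## §3 No exponent above `1/2` -/

/-- **No exponent above `1/2`.** The strengthening of the crux
(`DilatedChowla = DilatedChowlaAbove 0`, `dilatedChowla_iff_above_zero`) to the exponent floor
`1/2` is false: at `c = 1` the Welch floor gives, for every `M ≥ 2`, a pair `1 ≤ n ≠ n' ≤ 2M` with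
`√(M/2) ≤ |S 1 n n' M| ≤ C · M^{1-κ}`, i.e. `M^{κ-1/2} ≤ √2 · C`, impossible for `κ > 1/2` and
`M → ∞`. -/
theorem not_dilatedChowlaAbove_half : ¬ DilatedChowlaAbove (1 / 2) := by
  intro h
  obtain ⟨κ, hκ, C, hC⟩ := h 1 one_ne_zero
  have hε : 0 < κ - 1 / 2 := by linarith
  -- pick `M ≥ 2` with `√2 · C < M^{κ - 1/2}`
  have ht : Tendsto (fun M : ℕ => (M : ℝ) ^ (κ - 1 / 2)) atTop atTop :=
    (tendsto_rpow_atTop hε).comp tendsto_natCast_atTop_atTop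
  obtain ⟨M, hM2, hMC⟩ :=
    ((eventually_ge_atTop 2).and (ht.eventually_gt_atTop (Real.sqrt 2 * C))).exists
  have hM2' : (2 : ℝ) ≤ M := by exact_mod_cast hM2
  have hx : (0 : ℝ) < M := by linarith
  have habs : (|(1 : ℤ)| : ℝ) < M := by norm_num; linarith
  obtain ⟨n, n', hn, hn', hne, hn2, hn2', hle⟩ := exists_abs_S_ge_sqrt 1 M habs
  -- `√(M/2) ≤ |S| ≤ C · M^{1-κ}`, i.e. `M^{1/2} ≤ C · M^{1-κ} · √2`
  have key : Real.sqrt ((M : ℝ) / 2) ≤ C * (M : ℝ) ^ (1 - κ) :=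
    le_trans hle (hC M n n' hn hn' hne hn2 hn2')
  rw [Real.sqrt_div' _ zero_le_two, Real.sqrt_eq_rpow (M : ℝ),
    div_le_iff₀ (Real.sqrt_pos.mpr zero_lt_two)] at key
  -- while `√2 · C · M^{1-κ} < M^{1/2}`
  have hMC' : Real.sqrt 2 * C < (M : ℝ) ^ (1 / 2 : ℝ) / (M : ℝ) ^ (1 - κ) := by
    rw [← Real.rpow_sub hx, show (1 : ℝ) / 2 - (1 - κ) = κ - 1 / 2 by ring]
    exact hMC
  rw [lt_div_iff₀ (Real.rpow_pos_of_pos hx _)] at hMC'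
  linarith

end Summit.Parity.GeneralizedHardyLittlewood.Theorems.DilatedChowla.Negative

end
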